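import Summits.AtomisticToContinuum.HydrodynamicLimit.Theorems.RelayRaceLocalityNearConstantShortTimeHLTorusCells
import Summits.AtomisticToContinuum.HydrodynamicLimit.Theorems.RelayRaceLocalityNearConstantShortTimeHLPiLemmas
import Mathlib.Analysis.Convex.Integral
import HarnessLib

/-!
# Crux `NearConstantShortTimeHL` (stmt-AtomisticToContinuum-12502), line `small-tilt-domination` — stub `cells_jensen`

Support file for the crux `…Theses.RelayRaceLocality.NearConstantShortTimeHL`, line
`small-tilt-domination`, registered stub `cells_jensen` (wave 1, W2): the cellwise Jensen step that
reduces an exponential moment of the *integral* statistic `exp (c ∫_{𝕋³} f)` to an exponential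
moment of a *linear* statistic of one sample point per cell.

The flat torus `𝕋³ = UnitAddTorus (Fin 3)` (Haar probability `volume`) is cut into the `k³`
half-open cells `A j = {y | gridIndex k (repr y) = finIndex j}`, `j : Fin 3 → Fin k`, each of volume
`k⁻³` (`volume_cell`, `iUnion_cell_eq_univ`, `pairwise_disjoint_cell` from `…TorusCells`). Then

* `∫ f = Σ_j ∫_{A j} f`, so `exp (c ∫ f) = ∏_j exp (c ∫_{A j} f)`;
* Jensen on each cell for the convex `Real.exp` and the normalised cell measure `k³ · volume|_{A j}`
  (`ConvexOn.map_set_average_le`): `exp (c ∫_{A j} f) = exp (⨍_{A j} (c k⁻³) f) ≤ ⨍_{A j} exp (c k⁻³ f)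
  = k³ ∫_{A j} exp (c k⁻³ f)`;
* the product of the cell integrals is the integral over the product measure
  `Measure.pi (j ↦ volume|_{A j})` of `∏_j exp (c k⁻³ f (ys j)) = exp (c k⁻³ Σ_j f (ys j))` (Tonelli
  for finite products, `lintegral_fintype_prod_eq_prod'`), and `∏_j k³ = (k³)^(k³)`.

References: folklore (Jensen's inequality and Tonelli's theorem).
-/

noncomputable section

namespace Summit.AtomisticToContinuum.HydrodynamicLimit.Theorems.NearConstantShortTimeHL

open scoped BigOperators ENNReal
open MeasureTheory Set Filter Topology
open Literature.MathematicalPhysics.KineticTheory Literature.Analysis.FluidPDE Literature.Analysis.FunctionSpaces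

/-- A bounded measurable real function on `𝕋³` is integrable (Haar measure is a probability
measure). [folklore] -/
theorem cj_integrable_of_bounded {f : T3 → ℝ} (hf : Measurable f) {C : ℝ} (hC : ∀ y, |f y| ≤ C) :
    Integrable f (volume : Measure T3) :=
  Integrable.of_bound hf.aestronglyMeasurable C
    (ae_of_all _ fun y => by simpa only [Real.norm_eq_abs] using hC y)

/-- For `0 ≤ a` and `|f| ≤ C`, the function `exp (a f)` is integrable on `𝕋³` (it is measurable and
bounded by `exp (a C)`). [folklore] -/
theorem cj_integrable_exp_mul {f : T3 → ℝ} (hf : Measurable f) {C : ℝ} (hC : ∀ y, |f y| ≤ C)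
    {a : ℝ} (ha : 0 ≤ a) :
    Integrable (fun y => Real.exp (a * f y)) (volume : Measure T3) := by
  refine Integrable.of_bound (measurable_const.mul hf).exp.aestronglyMeasurable (Real.exp (a * C))
    (ae_of_all _ fun y => ?_)
  rw [Real.norm_eq_abs, Real.abs_exp, Real.exp_le_exp]
  exact mul_le_mul_of_nonneg_left ((le_abs_self _).trans (hC y)) ha

/-- **Jensen on one cell.** For a cell `A j` (volume `k⁻³`), `0 ≤ c` and a bounded measurable `f`,
`exp (c ∫_{A j} f) ≤ k³ ∫_{A j} exp (c k⁻³ f)`, stated in `ℝ≥0∞`. This is Jensen's inequality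
`exp (⨍ g) ≤ ⨍ exp g` (`ConvexOn.map_set_average_le`) for `g = c k⁻³ f` and the cell average
`⨍_{A j} = k³ ∫_{A j}`. [folklore] -/
theorem cj_cell_jensen {k : ℕ} (hk : 0 < k) {f : T3 → ℝ} (hf : Measurable f) {C : ℝ}
    (hC : ∀ y, |f y| ≤ C) {c : ℝ} (hc : 0 ≤ c) (j : Fin 3 → Fin k) :
    ENNReal.ofReal (Real.exp (c * ∫ y in {y : T3 | Torus.gridIndex k (Torus.repr y) = Torus.finIndex j}, f y)) ≤
      (k : ℝ≥0∞) ^ 3 * ∫⁻ y in {y : T3 | Torus.gridIndex k (Torus.repr y) = Torus.finIndex j},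
        ENNReal.ofReal (Real.exp (c * ((k : ℝ) ^ 3)⁻¹ * f y)) := by
  set A : Set T3 := {y : T3 | Torus.gridIndex k (Torus.repr y) = Torus.finIndex j}
  have hk' : (0 : ℝ) < k := by exact_mod_cast hk
  have hN : (0 : ℝ) < (k : ℝ) ^ 3 := by positivity
  have ha : 0 ≤ c * ((k : ℝ) ^ 3)⁻¹ := mul_nonneg hc (inv_nonneg.2 hN.le)
  -- volume of the cell
  have hvol : volume A = ((k : ℝ≥0∞)⁻¹) ^ 3 := volume_cell hk j
  have hvol0 : volume A ≠ 0 := by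
    rw [hvol]
    exact pow_ne_zero _ (ENNReal.inv_ne_zero.2 (ENNReal.natCast_ne_top k))
  have hvolR : (volume A).toReal = ((k : ℝ) ^ 3)⁻¹ := by
    rw [hvol, ENNReal.toReal_pow, ENNReal.toReal_inv, ENNReal.toReal_natCast, inv_pow]
  -- integrability
  have hfi : IntegrableOn f A volume := (cj_integrable_of_bounded hf hC).integrableOn
  have hgi : IntegrableOn (fun y => c * ((k : ℝ) ^ 3)⁻¹ * f y) A volume := hfi.const_mul _
  have hei : IntegrableOn (fun y => Real.exp (c * ((k : ℝ) ^ 3)⁻¹ * f y)) A volume :=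
    (cj_integrable_exp_mul hf hC ha).integrableOn
  -- Jensen
  have hJ := ConvexOn.map_set_average_le (μ := volume) (t := A)
    (f := fun y => c * ((k : ℝ) ^ 3)⁻¹ * f y) (g := Real.exp) (s := univ) convexOn_exp
    Real.continuous_exp.continuousOn isClosed_univ hvol0 (measure_ne_top _ _)
    (Eventually.of_forall fun _ => mem_univ _) hgi hei
  have hcoef : (k : ℝ) ^ 3 * (c * ((k : ℝ) ^ 3)⁻¹) = c := by
    rw [mul_comm, mul_assoc, inv_mul_cancel₀ hN.ne', mul_one]
  rw [setAverage_eq, setAverage_eq, measureReal_def, hvolR, inv_inv, smul_eq_mul, smul_eq_mul,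
    integral_const_mul, ← mul_assoc, hcoef] at hJ
  -- pass to `ℝ≥0∞`
  calc ENNReal.ofReal (Real.exp (c * ∫ y in A, f y))
      ≤ ENNReal.ofReal ((k : ℝ) ^ 3 * ∫ y in A, Real.exp (c * ((k : ℝ) ^ 3)⁻¹ * f y)) :=
        ENNReal.ofReal_le_ofReal hJ
    _ = (k : ℝ≥0∞) ^ 3 * ∫⁻ y in A, ENNReal.ofReal (Real.exp (c * ((k : ℝ) ^ 3)⁻¹ * f y)) := by
        rw [ENNReal.ofReal_mul hN.le, ENNReal.ofReal_pow hk'.le, ENNReal.ofReal_natCast,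
          ofReal_integral_eq_lintegral_ofReal hei (ae_of_all _ fun y => (Real.exp_pos _).le)]

/-- **Cellwise Jensen.** For `0 < k`, a bounded measurable `f : 𝕋³ → ℝ` and `0 ≤ c`,
`exp (c ∫ f) ≤ (k³)^(k³) ∫ exp (c k⁻³ Σ_j f (ys j)) d(⊗_j volume|_{A j})(ys)`, the product running over
the `k³` cells `A j = {y | gridIndex k (repr y) = finIndex j}` of `𝕋³`: split `∫ f` along the cells,
apply Jensen on each cell (`cj_cell_jensen`) and Tonelli for the finite product measure
(`lintegral_fintype_prod_eq_prod'`). Registered stub `cells_jensen` of the line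
`small-tilt-domination`. [folklore] -/
theorem cells_jensen : ∀ {k : ℕ}, 0 < k → ∀ {f : T3 → ℝ}, Measurable f → (∃ C : ℝ, ∀ y, |f y| ≤ C) → ∀ {c : ℝ}, 0 ≤ c → ENNReal.ofReal (Real.exp (c * ∫ y, f y)) ≤ ((k : ℝ≥0∞) ^ 3) ^ (k ^ 3) * ∫⁻ ys, ENNReal.ofReal (Real.exp (c * ((k : ℝ) ^ 3)⁻¹ * ∑ j, f (ys j))) ∂Measure.pi (fun j : Fin 3 → Fin k => (volume : Measure T3).restrict {y : T3 | Torus.gridIndex k (Torus.repr y) = Torus.finIndex j}) := by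
  intro k hk f hf hbdd c hc
  obtain ⟨C, hC⟩ := hbdd
  set A : (Fin 3 → Fin k) → Set T3 := fun j =>
    {y : T3 | Torus.gridIndex k (Torus.repr y) = Torus.finIndex j}
  set G : T3 → ℝ≥0∞ := fun y => ENNReal.ofReal (Real.exp (c * ((k : ℝ) ^ 3)⁻¹ * f y)) with hG
  have hGm : Measurable G := ENNReal.measurable_ofReal.comp (measurable_const.mul hf).exp
  -- Tonelli for the finite product of the restricted measures
  have hpi : ∫⁻ ys, ENNReal.ofReal (Real.exp (c * ((k : ℝ) ^ 3)⁻¹ * ∑ j, f (ys j)))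
      ∂Measure.pi (fun j : Fin 3 → Fin k => (volume : Measure T3).restrict (A j)) =
        ∏ j, ∫⁻ y in A j, G y := by
    rw [← lintegral_fintype_prod_eq_prod' (fun j : Fin 3 → Fin k => (volume : Measure T3).restrict (A j))
      (f := fun _ => G) (fun _ => hGm)]
    refine lintegral_congr fun ys => ?_
    simp only [hG]
    rw [← ENNReal.ofReal_prod_of_nonneg fun j _ => (Real.exp_pos _).le, ← Real.exp_sum,
      Finset.mul_sum]
  -- the Bochner integral splits along the cells
  have hsplit : ∫ y, f y = ∑ j : Fin 3 → Fin k, ∫ y in A j, f y := by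
    rw [← setIntegral_univ (μ := volume), ← iUnion_cell_eq_univ hk]
    exact integral_iUnion_fintype (fun j => measurableSet_cell hk j) pairwise_disjoint_cell
      fun j => (cj_integrable_of_bounded hf hC).integrableOn
  rw [hpi]
  calc ENNReal.ofReal (Real.exp (c * ∫ y, f y))
      = ∏ j : Fin 3 → Fin k, ENNReal.ofReal (Real.exp (c * ∫ y in A j, f y)) := by
        rw [hsplit, Finset.mul_sum, Real.exp_sum,
          ENNReal.ofReal_prod_of_nonneg fun j _ => (Real.exp_pos _).le]
    _ ≤ ∏ j : Fin 3 → Fin k, ((k : ℝ≥0∞) ^ 3 * ∫⁻ y in A j, G y) :=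
        Finset.prod_le_prod' fun j _ => cj_cell_jensen hk hf hC hc j
    _ = ((k : ℝ≥0∞) ^ 3) ^ (k ^ 3) * ∏ j : Fin 3 → Fin k, ∫⁻ y in A j, G y := by
        rw [Finset.prod_mul_distrib, Finset.prod_const, Finset.card_univ, Fintype.card_fun,
          Fintype.card_fin, Fintype.card_fin]

end Summit.AtomisticToContinuum.HydrodynamicLimit.Theorems.NearConstantShortTimeHL

end
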